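import Mathlib

/-!
# Packing bound for ordered escape ladders in an arbitrary finite abelian host (support file)

Item `stmt-MatrixMultiplication-14308` (`FourierTwoFamiliesModP.PrimeTwoFamilies`, CKSU 2005
Conj. 4.7 with prime cyclic hosts), line Sketch, registered stub `ladder_card_mul_sqrt_le`
(siege attempt k11, variation "reduce to landed lemmas, then assemble").

An ORDERED ESCAPE LADDER in an abelian group `G` is a family of `r` classes `(X c, Y c)`,
`c : Fin r`, such that for classes `p < q` every lower cross difference `y' - x'`
(`x' ∈ X p`, `y' ∈ Y q`) differs from every diagonal difference `y - x` (`x ∈ X c`, `y ∈ Y c`,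
any class `c`) — hypothesis `hL` below (directness of the classes is NOT used in this file).

What is proved here, for ANY finite host `G` (so that it applies verbatim to the product ladders
in `G₁ × G₂` produced by `LadderLift.isLadder_lexProd`, before any CRT transport to a cyclic host):

* `disjoint_left_of_lt` / `disjoint_right_of_lt`: `hL` at `c = q` (resp. `c = p`) with the trivial
  coincidence `y - x = y - x` makes `X p`, `X q` disjoint as soon as `Y q ≠ ∅`, and `Y p`, `Y q`
  disjoint as soon as `X p ≠ ∅`;
* `sum_card_add_card_le` (perimeter bound): over any set `S` of classes with both sides non-empty,
  `∑_{c ∈ S} (|X c| + |Y c|) ≤ 2 |G|`;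
* `sum_sqrt_card_mul_card_le` (no hypothesis besides `hL`): `∑_c √(|X c| |Y c|) ≤ |G|`
  (classes with an empty side contribute `0`; AM–GM on the others);
* `card_mul_sqrt_le_card`: if every class has co-volume `|X c| |Y c| ≥ P` then `r √P ≤ |G|`
  (no positivity assumption on `P` is needed);
* `ladder_card_mul_sqrt_le`: the registered stub, i.e. the specialisation `G = ZMod m`
  (`|G| = m`); its hypothesis `0 < P` is part of the registered signature but logically redundant.

The `ZMod m` statement coincides with `LadderLift.ladder_card_mul_sqrt_le` of the tree file
`FourierTwoFamiliesModPPrimeTwoFamiliesLadderPacking.lean`; the point of this file is the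
host-general, positivity-free `∑ √` form from which it is assembled.
-/

-- single-conjunct summit: the mandated namespace repeats `MatrixMultiplication` (summit = sub-problem).
set_option linter.dupNamespace false

namespace Summit.MatrixMultiplication.MatrixMultiplication.Theorems.PrimeTwoFamilies.LadderHost

open Finset

/-- In an ordered escape ladder, `X p` and `X q` (`p < q`) are disjoint as soon as `Y q` is
non-empty: a common point `x₀` and any `y₀ ∈ Y q` give the diagonal difference `y₀ - x₀` of class
`q` equal to the cross difference `y₀ - x₀` between `X p` and `Y q`, against `hL` at `c = q`. -/
theorem disjoint_left_of_lt {G : Type*} [AddCommGroup G] {r : ℕ} (X Y : Fin r → Finset G)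
    (hL : ∀ c p q : Fin r, p < q → ∀ x ∈ X c, ∀ y ∈ Y c, ∀ x' ∈ X p, ∀ y' ∈ Y q, y - x ≠ y' - x')
    {p q : Fin r} (hpq : p < q) (hq : (Y q).Nonempty) : Disjoint (X p) (X q) := by
  rw [Finset.disjoint_left]
  intro x hxp hxq
  obtain ⟨y, hy⟩ := hq
  exact hL q p q hpq x hxq y hy x hxp y hy rfl

/-- In an ordered escape ladder, `Y p` and `Y q` (`p < q`) are disjoint as soon as `X p` is
non-empty: a common point `y₀` and any `x₀ ∈ X p` give the diagonal difference `y₀ - x₀` of class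
`p` equal to the cross difference `y₀ - x₀` between `X p` and `Y q`, against `hL` at `c = p`. -/
theorem disjoint_right_of_lt {G : Type*} [AddCommGroup G] {r : ℕ} (X Y : Fin r → Finset G)
    (hL : ∀ c p q : Fin r, p < q → ∀ x ∈ X c, ∀ y ∈ Y c, ∀ x' ∈ X p, ∀ y' ∈ Y q, y - x ≠ y' - x')
    {p q : Fin r} (hpq : p < q) (hp : (X p).Nonempty) : Disjoint (Y p) (Y q) := by
  rw [Finset.disjoint_left]
  intro y hyp hyq
  obtain ⟨x, hx⟩ := hp
  exact hL p p q hpq x hx y hyp x hx y hyq rfl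

/-- **Perimeter bound.**  Over any set `S` of classes of an ordered escape ladder all of which have
both sides non-empty, the `X`-sides are pairwise disjoint and the `Y`-sides are pairwise disjoint,
so `∑_{c ∈ S} (|X c| + |Y c|) ≤ 2 |G|`. -/
theorem sum_card_add_card_le {G : Type*} [AddCommGroup G] [Fintype G] {r : ℕ}
    (X Y : Fin r → Finset G)
    (hL : ∀ c p q : Fin r, p < q → ∀ x ∈ X c, ∀ y ∈ Y c, ∀ x' ∈ X p, ∀ y' ∈ Y q, y - x ≠ y' - x')
    (S : Finset (Fin r)) (hS : ∀ c ∈ S, (X c).Nonempty ∧ (Y c).Nonempty) :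
    ∑ c ∈ S, ((X c).card + (Y c).card) ≤ 2 * Fintype.card G := by
  classical
  have hX : (S : Set (Fin r)).PairwiseDisjoint X := by
    intro p hp q hq hpq
    rcases lt_or_gt_of_ne hpq with h | h
    · exact disjoint_left_of_lt X Y hL h (hS q hq).2
    · exact (disjoint_left_of_lt X Y hL h (hS p hp).2).symm
  have hY : (S : Set (Fin r)).PairwiseDisjoint Y := by
    intro p hp q hq hpq
    rcases lt_or_gt_of_ne hpq with h | h
    · exact disjoint_right_of_lt X Y hL h (hS p hp).1
    · exact (disjoint_right_of_lt X Y hL h (hS q hq).1).symm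
  have h1 : ∑ c ∈ S, (X c).card ≤ Fintype.card G := by
    rw [← Finset.card_biUnion hX]
    exact Finset.card_le_univ _
  have h2 : ∑ c ∈ S, (Y c).card ≤ Fintype.card G := by
    rw [← Finset.card_biUnion hY]
    exact Finset.card_le_univ _
  rw [Finset.sum_add_distrib]
  omega

/-- AM–GM in the form `√(a b) ≤ (a + b) / 2` for `a, b ≥ 0`. -/
private lemma sqrt_mul_le_add_div_two {a b : ℝ} (ha : 0 ≤ a) (hb : 0 ≤ b) :
    Real.sqrt (a * b) ≤ (a + b) / 2 := by
  rw [Real.sqrt_mul ha]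
  nlinarith [sq_nonneg (Real.sqrt a - Real.sqrt b), Real.sq_sqrt ha, Real.sq_sqrt hb,
    Real.sqrt_nonneg a, Real.sqrt_nonneg b]

/-- **Square-root packing bound** (host-general, no side conditions).  For an ordered escape ladder
`(X c, Y c)_{c < r}` in a finite abelian group `G`, `∑_c √(|X c| · |Y c|) ≤ |G|`: classes with an
empty side contribute `0`, and on the set `S` of the other classes AM–GM and the perimeter bound
give `∑_{c ∈ S} √(|X c| |Y c|) ≤ ∑_{c ∈ S} (|X c| + |Y c|) / 2 ≤ |G|`. -/
theorem sum_sqrt_card_mul_card_le {G : Type*} [AddCommGroup G] [Fintype G] {r : ℕ}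
    (X Y : Fin r → Finset G)
    (hL : ∀ c p q : Fin r, p < q → ∀ x ∈ X c, ∀ y ∈ Y c, ∀ x' ∈ X p, ∀ y' ∈ Y q, y - x ≠ y' - x') :
    ∑ c, Real.sqrt (((X c).card * (Y c).card : ℕ) : ℝ) ≤ (Fintype.card G : ℝ) := by
  classical
  set S : Finset (Fin r) := univ.filter fun c => (X c).Nonempty ∧ (Y c).Nonempty with hS
  have hmem : ∀ c, c ∈ S ↔ (X c).Nonempty ∧ (Y c).Nonempty := fun c => by
    rw [hS, Finset.mem_filter]
    exact ⟨fun h => h.2, fun h => ⟨Finset.mem_univ _, h⟩⟩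
  -- classes with an empty side contribute nothing
  have hvanish : ∀ c ∈ (univ : Finset (Fin r)), c ∉ S →
      Real.sqrt (((X c).card * (Y c).card : ℕ) : ℝ) = 0 := by
    intro c _ hc
    rw [hmem, not_and_or, Finset.not_nonempty_iff_eq_empty, Finset.not_nonempty_iff_eq_empty] at hc
    rcases hc with h | h <;> simp [h]
  rw [← Finset.sum_subset (Finset.subset_univ S) hvanish]
  -- AM–GM on the live classes, then the perimeter bound
  have hamgm : ∀ c ∈ S, Real.sqrt (((X c).card * (Y c).card : ℕ) : ℝ) ≤
      ((((X c).card + (Y c).card : ℕ) : ℝ)) / 2 := by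
    intro c _
    push_cast
    exact sqrt_mul_le_add_div_two (Nat.cast_nonneg _) (Nat.cast_nonneg _)
  have hper : ((∑ c ∈ S, ((X c).card + (Y c).card) : ℕ) : ℝ) ≤ ((2 * Fintype.card G : ℕ) : ℝ) := by
    exact_mod_cast sum_card_add_card_le X Y hL S fun c hc => (hmem c).1 hc
  calc ∑ c ∈ S, Real.sqrt (((X c).card * (Y c).card : ℕ) : ℝ)
      ≤ ∑ c ∈ S, ((((X c).card + (Y c).card : ℕ) : ℝ)) / 2 := Finset.sum_le_sum hamgm
    _ = ((∑ c ∈ S, ((X c).card + (Y c).card) : ℕ) : ℝ) / 2 := by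
      rw [Nat.cast_sum, Finset.sum_div]
    _ ≤ ((2 * Fintype.card G : ℕ) : ℝ) / 2 := by gcongr
    _ = (Fintype.card G : ℝ) := by push_cast; ring

/-- **Packing bound, host-general form.**  If every class of an ordered escape ladder
`(X c, Y c)_{c < r}` in a finite abelian group `G` has co-volume `|X c| · |Y c| ≥ P`, then
`r · √P ≤ |G|` (for `P ≤ 0` this is trivial since `√P = 0`; no positivity hypothesis is needed). -/
theorem card_mul_sqrt_le_card {G : Type*} [AddCommGroup G] [Fintype G] {r : ℕ}
    (X Y : Fin r → Finset G)
    (hL : ∀ c p q : Fin r, p < q → ∀ x ∈ X c, ∀ y ∈ Y c, ∀ x' ∈ X p, ∀ y' ∈ Y q, y - x ≠ y' - x')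
    {P : ℝ} (hP : ∀ c : Fin r, P ≤ (((X c).card * (Y c).card : ℕ) : ℝ)) :
    (r : ℝ) * Real.sqrt P ≤ (Fintype.card G : ℝ) :=
  calc (r : ℝ) * Real.sqrt P = ∑ _c : Fin r, Real.sqrt P := by
        rw [Finset.sum_const, Finset.card_univ, Fintype.card_fin, nsmul_eq_mul]
    _ ≤ ∑ c, Real.sqrt (((X c).card * (Y c).card : ℕ) : ℝ) :=
        Finset.sum_le_sum fun c _ => Real.sqrt_le_sqrt (hP c)
    _ ≤ (Fintype.card G : ℝ) := sum_sqrt_card_mul_card_le X Y hL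

/-- **Packing bound for ordered escape ladders in `ZMod m`** (registered stub
`ladder_card_mul_sqrt_le` of item `stmt-MatrixMultiplication-14308`, verbatim signature).  If
`(X c, Y c)_{c < r}` is an ordered escape ladder in `ZMod m` (hypothesis `hL`) all of whose classes
have co-volume `|X c| · |Y c| ≥ P > 0`, then `r · √P ≤ m`.  Assembled from the host-general bound
`card_mul_sqrt_le_card` and `|ZMod m| = m`; the hypothesis `0 < P` belongs to the registered
signature and is not needed by the proof. -/
theorem ladder_card_mul_sqrt_le {m : ℕ} [NeZero m] {r : ℕ} (X Y : Fin r → Finset (ZMod m))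
    (hL : ∀ c p q : Fin r, p < q → ∀ x ∈ X c, ∀ y ∈ Y c, ∀ x' ∈ X p, ∀ y' ∈ Y q, y - x ≠ y' - x')
    {P : ℝ} (hP0 : 0 < P) (hP : ∀ c : Fin r, P ≤ (((X c).card * (Y c).card : ℕ) : ℝ)) :
    (r : ℝ) * Real.sqrt P ≤ (m : ℝ) := by
  have _ := hP0 -- logically redundant: kept only because it is part of the registered signature
  simpa only [ZMod.card] using card_mul_sqrt_le_card X Y hL hP

end Summit.MatrixMultiplication.MatrixMultiplication.Theorems.PrimeTwoFamilies.LadderHost
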